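import Summits.QuantumFields.QCD.Theorems.PauliWegnerSeaFMClosureUnquenchedTwoStarC1Aux1
import Summits.QuantumFields.QCD.Theorems.PauliWegnerSeaFMClosureUnquenchedTwoStarC1Aux2

/-!
# Crux `FMClosureUnquenched` (stmt-QuantumFields-11512), line `von-mises-circles`, stub `stub_twoStar` —
helper 4: the fibre polynomials of the two-star package, measurability, stars

* Clause (a): `det (D_A ⊕ 1)`, every adjugate entry of `D_A ⊕ 1` and `det D` are fibre polynomials of degree `4`
  (`isFibrePoly_sideDet`, `isFibrePoly_sideAdj`, `isFibrePoly_det_wilsonD`: helpers 1 + 2), and the multi-flavour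
  Wilson determinant `det 𝔇 = ∏_f det D_f` is a fibre polynomial of degree `4 N_f` (`isFibrePoly_det_diracMatrix`).
* Measurability of the block norms of side-wise Green functions (`measurable_blockNorm_gside`), through Cramer's
  formula `M⁻¹ = (det M)⁻¹ • adj M` (the entries are NOT continuous at singular matrices).
* The two stars of a pair of sites have at most `16` links (`card_filter_twoStar_le`), two pairs at most `32`.
* Locality: a side-wise Green function `G_A` does not read the links of a fibre none of whose links joins two sites
  of `A` (`sideMatrix_wilsonD_refit_eq`), the mechanism of clause (T1).

References: Aizenman–Schenker–Friedrich–Hundertmark, CMP 224 (2001) 219, §2 [AizenmanEtAl2001]; Montvay–Münster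
§4.2.2, §5.1.1 [MontvayMunster1994].
-/

noncomputable section

open scoped BigOperators
open MeasureTheory
open Literature.MathematicalPhysics.QuantumFieldTheory Literature.MathematicalPhysics.QuantumLattice
  Literature.Probability.LatticeModels
open Summit.QuantumFields.QCD.Theorems.VonMisesCircles

namespace Summit.QuantumFields.QCD.Theorems.VonMisesCirclesC1

variable {N : ℕ} [NeZero N]

/-! ## Clause (a): the fibre polynomials -/

/-- `W ↦ det (D_A ⊕ 1)(W)` is a fibre polynomial of degree `4`. [folklore] -/
theorem isFibrePoly_sideDet (A : Finset (TorusSite 4 N)) (m₀ : ℝ) :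
    IsFibrePoly 4 (fun W : GaugeConfig 4 N (Matrix.specialUnitaryGroup (Fin 3) ℂ) =>
      (sideMatrix A (wilsonD W m₀)).det) :=
  ⟨(continuous_sideMatrix_wilsonD A m₀).matrix_det,
    fun W e V B T hT => sideDet_conjCircle_trigPoly W m₀ e V B T hT A⟩

/-- Every adjugate entry of `D_A ⊕ 1` is a fibre polynomial of degree `4`. [folklore] -/
theorem isFibrePoly_sideAdj (A : Finset (TorusSite 4 N)) (m₀ : ℝ) (i j : QIdx N) :
    IsFibrePoly 4 (fun W : GaugeConfig 4 N (Matrix.specialUnitaryGroup (Fin 3) ℂ) =>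
      (sideMatrix A (wilsonD W m₀)).adjugate i j) :=
  ⟨((continuous_sideMatrix_wilsonD A m₀).matrix_adjugate).matrix_elem i j,
    fun W e V B T hT => sideAdjugate_conjCircle_trigPoly W m₀ e V B T hT A i j⟩

/-- `W ↦ det D(W)` (one flavour) is a fibre polynomial of degree `4` (`PauliBandLimit` along conjugate
circles). [folklore] -/
theorem isFibrePoly_det_wilsonD (m₀ : ℝ) :
    IsFibrePoly 4 (fun W : GaugeConfig 4 N (Matrix.specialUnitaryGroup (Fin 3) ℂ) => (wilsonD W m₀).det) := by
  have h := isFibrePoly_sideDet (N := N) Finset.univ m₀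
  simp_rw [sideMatrix_univ] at h
  exact h

/-- Every adjugate entry of the one-flavour `D(W)` is a fibre polynomial of degree `4`. [folklore] -/
theorem isFibrePoly_adj_wilsonD (m₀ : ℝ) (i j : QIdx N) :
    IsFibrePoly 4 (fun W : GaugeConfig 4 N (Matrix.specialUnitaryGroup (Fin 3) ℂ) =>
      (wilsonD W m₀).adjugate i j) := by
  have h := isFibrePoly_sideAdj (N := N) Finset.univ m₀ i j
  simp_rw [sideMatrix_univ] at h
  exact h

/-- **`det 𝔇 = ∏_f det D_f` is a fibre polynomial of degree `4 N_f`.** [folklore] -/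
theorem isFibrePoly_det_diracMatrix {Nf : ℕ} (mq : Fin Nf → ℝ) :
    IsFibrePoly (4 * Nf) (fun W : GaugeConfig 4 N (Matrix.specialUnitaryGroup (Fin 3) ℂ) =>
      (diracMatrix W mq).det) := by
  have h := fibrePoly_prod (N := N) (Finset.univ : Finset (Fin Nf))
    (fun f W => (wilsonD W (mq f)).det) 4 fun f _ => isFibrePoly_det_wilsonD (mq f)
  rw [Finset.card_univ, Fintype.card_fin, mul_comm] at h
  refine ⟨?_, ?_⟩
  · simp_rw [det_diracMatrix]
    exact h.1
  · intro W e V B T hT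
    have h2 := h.2 W e V B T hT
    simp_rw [det_diracMatrix]
    exact h2

/-! ## Measurability of the block norms of Green functions -/

/-- Block norms of the inverse of a continuously varying matrix are measurable (Cramer's formula; the inverse
is the junk `0` on the closed singular set). [folklore] -/
theorem measurable_blockNorm_inv_of_continuous
    {M : GaugeConfig 4 N (Matrix.specialUnitaryGroup (Fin 3) ℂ) → Matrix (QIdx N) (QIdx N) ℂ}
    (hM : Continuous M) (x y : TorusSite 4 N) :
    Measurable fun U => blockNorm (M U)⁻¹ x y := by
  unfold blockNorm
  refine Finset.measurable_sum _ fun a _ => Finset.measurable_sum _ fun i _ =>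
    Finset.measurable_sum _ fun b _ => Finset.measurable_sum _ fun j _ => ?_
  have h : (fun U => ‖(M U)⁻¹ (x, a, i) (y, b, j)‖) =
      fun U => ‖((M U).det)⁻¹ * (M U).adjugate (x, a, i) (y, b, j)‖ := by
    funext U
    rw [Matrix.inv_def, Ring.inverse_eq_inv, Matrix.smul_apply, smul_eq_mul]
  rw [h]
  exact (hM.matrix_det.measurable.inv.mul (hM.matrix_adjugate.matrix_elem _ _).measurable).norm

/-- Block norms of side-wise Green functions of the Wilson–Dirac matrix are measurable in the field. [folklore] -/
theorem measurable_blockNorm_gside (A : Finset (TorusSite 4 N)) (m₀ : ℝ) (x y : TorusSite 4 N) :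
    Measurable fun U : GaugeConfig 4 N (Matrix.specialUnitaryGroup (Fin 3) ℂ) =>
      blockNorm (gside A (wilsonD U m₀)) x y :=
  measurable_blockNorm_inv_of_continuous (continuous_sideMatrix_wilsonD A m₀) x y

/-- Block norms of the full Green function `D⁻¹` are measurable in the field. [folklore] -/
theorem measurable_blockNorm_inv_wilsonD (m₀ : ℝ) (x y : TorusSite 4 N) :
    Measurable fun U : GaugeConfig 4 N (Matrix.specialUnitaryGroup (Fin 3) ℂ) => blockNorm (wilsonD U m₀)⁻¹ x y :=
  measurable_blockNorm_inv_of_continuous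
    (continuous_wilsonDirac (fundamentalRep (Fin 3)) (continuous_fundamentalRep (Fin 3)) m₀ 1) x y

/-- `gside univ M = M⁻¹`. [folklore] -/
theorem gside_univ (M : Matrix (QIdx N) (QIdx N) ℂ) : gside Finset.univ M = M⁻¹ := by
  rw [gside, sideMatrix_univ]

/-! ## Stars -/

omit [NeZero N] in
/-- Cardinality of a filter by a disjunction. [folklore] -/
theorem card_filter_or_le' {α : Type*} [DecidableEq α] (s : Finset α) (p q : α → Prop) [DecidablePred p]
    [DecidablePred q] : (s.filter fun a => p a ∨ q a).card ≤ (s.filter p).card + (s.filter q).card := by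
  rw [Finset.filter_or]
  exact Finset.card_union_le _ _

/-- The links issuing from a site are at most `4`. [folklore] -/
theorem card_filter_fst_eq_le (x : TorusSite 4 N) :
    (Finset.univ.filter fun e : Edge 4 N => e.1 = x).card ≤ 4 := by
  calc (Finset.univ.filter fun e : Edge 4 N => e.1 = x).card
      ≤ ((Finset.univ : Finset (Fin 4)).image fun μ => ((x, μ) : Edge 4 N)).card := by
        refine Finset.card_le_card fun e he => ?_
        rw [Finset.mem_filter] at he
        rw [Finset.mem_image]
        exact ⟨e.2, Finset.mem_univ _, by rw [← he.2]⟩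
    _ ≤ (Finset.univ : Finset (Fin 4)).card := Finset.card_image_le
    _ = 4 := by simp

/-- The links arriving at a site are at most `4`. [folklore] -/
theorem card_filter_shift_eq_le (x : TorusSite 4 N) :
    (Finset.univ.filter fun e : Edge 4 N => Site.shift e.1 e.2 = x).card ≤ 4 := by
  calc (Finset.univ.filter fun e : Edge 4 N => Site.shift e.1 e.2 = x).card
      ≤ ((Finset.univ : Finset (Fin 4)).image fun μ => ((x - Pi.single μ 1, μ) : Edge 4 N)).card := by
        refine Finset.card_le_card fun e he => ?_
        rw [Finset.mem_filter] at he
        rw [Finset.mem_image]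
        refine ⟨e.2, Finset.mem_univ _, ?_⟩
        have h2 : e.1 = x - Pi.single e.2 1 := by
          rw [← he.2, Literature.MathematicalPhysics.QuantumFieldTheory.Site.shift, add_sub_cancel_right]
        rw [← h2]
    _ ≤ (Finset.univ : Finset (Fin 4)).card := Finset.card_image_le
    _ = 4 := by simp

/-- **The two stars of `x, y` have at most `16` links.** [folklore] -/
theorem card_filter_twoStar_le (x y : TorusSite 4 N) :
    (Finset.univ.filter fun e : Edge 4 N =>
      e.1 = x ∨ Site.shift e.1 e.2 = x ∨ e.1 = y ∨ Site.shift e.1 e.2 = y).card ≤ 16 := by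
  have h1 := card_filter_fst_eq_le (N := N) x
  have h2 := card_filter_shift_eq_le (N := N) x
  have h3 := card_filter_fst_eq_le (N := N) y
  have h4 := card_filter_shift_eq_le (N := N) y
  have e1 := card_filter_or_le' (Finset.univ : Finset (Edge 4 N)) (fun e => e.1 = x)
    (fun e => Site.shift e.1 e.2 = x ∨ e.1 = y ∨ Site.shift e.1 e.2 = y)
  have e2 := card_filter_or_le' (Finset.univ : Finset (Edge 4 N)) (fun e => Site.shift e.1 e.2 = x)
    (fun e => e.1 = y ∨ Site.shift e.1 e.2 = y)
  have e3 := card_filter_or_le' (Finset.univ : Finset (Edge 4 N)) (fun e => e.1 = y)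
    (fun e => Site.shift e.1 e.2 = y)
  omega

/-- The union of the two-star sets of two pairs of sites has at most `32` links. [folklore] -/
theorem card_filter_twoStar_or_le (a b c d : TorusSite 4 N) :
    (Finset.univ.filter fun e : Edge 4 N =>
      (e.1 = a ∨ Site.shift e.1 e.2 = a ∨ e.1 = b ∨ Site.shift e.1 e.2 = b) ∨
      (e.1 = c ∨ Site.shift e.1 e.2 = c ∨ e.1 = d ∨ Site.shift e.1 e.2 = d)).card ≤ 32 := by
  have h1 := card_filter_twoStar_le (N := N) a b
  have h2 := card_filter_twoStar_le (N := N) c d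
  have e1 := card_filter_or_le' (Finset.univ : Finset (Edge 4 N))
    (fun e => e.1 = a ∨ Site.shift e.1 e.2 = a ∨ e.1 = b ∨ Site.shift e.1 e.2 = b)
    (fun e => e.1 = c ∨ Site.shift e.1 e.2 = c ∨ e.1 = d ∨ Site.shift e.1 e.2 = d)
  omega

/-! ## Locality -/

/-- **A side-wise Green function does not read the links of a fibre none of whose links joins two sites of
the side.** [folklore] -/
theorem sideMatrix_wilsonD_refit_eq (A : Finset (TorusSite 4 N)) (R : Finset (Edge 4 N))
    (hR : ∀ e ∈ R, ¬(e.1 ∈ A ∧ Site.shift e.1 e.2 ∈ A))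
    (U W : GaugeConfig 4 N (Matrix.specialUnitaryGroup (Fin 3) ℂ)) (m₀ : ℝ) :
    sideMatrix A (wilsonD (fun e => if e ∈ R then W e else U e) m₀) = sideMatrix A (wilsonD U m₀) := by
  refine sideMatrix_wilsonD_congr A _ U m₀ fun e he1 he2 => ?_
  have : e ∉ R := fun h => hR e h ⟨he1, he2⟩
  simp [this]

omit [NeZero N] in
/-- A link of the two stars of `u', v` with `u', v ∉ A` does not join two sites of `A`. [folklore] -/
theorem not_both_mem_of_twoStar {A : Finset (TorusSite 4 N)} {u' v : TorusSite 4 N} (hu : u' ∉ A) (hv : v ∉ A)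
    (e : Edge 4 N) (he : e.1 = u' ∨ Site.shift e.1 e.2 = u' ∨ e.1 = v ∨ Site.shift e.1 e.2 = v) :
    ¬(e.1 ∈ A ∧ Site.shift e.1 e.2 ∈ A) := by
  rintro ⟨h1, h2⟩
  rcases he with h | h | h | h
  · exact hu (h ▸ h1)
  · exact hu (h ▸ h2)
  · exact hv (h ▸ h1)
  · exact hv (h ▸ h2)

/-- A link of the two stars of `u', v ∈ Λ` does not join two sites of `Λᶜ`. [folklore] -/
theorem not_both_mem_compl_of_twoStar {Λ : Finset (TorusSite 4 N)} {u' v : TorusSite 4 N} (hu : u' ∈ Λ)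
    (hv : v ∈ Λ) (e : Edge 4 N) (he : e.1 = u' ∨ Site.shift e.1 e.2 = u' ∨ e.1 = v ∨ Site.shift e.1 e.2 = v) :
    ¬(e.1 ∈ Λᶜ ∧ Site.shift e.1 e.2 ∈ Λᶜ) := by
  refine not_both_mem_of_twoStar (A := Λᶜ) ?_ ?_ e he <;> simpa

/-- **Registered helper `stub_twoStar_aux4` of crux stmt-QuantumFields-11512** (line `von-mises-circles`, stub
`stub_twoStar`, clause (a)): the multi-flavour Wilson determinant `det 𝔇 = ∏_f det D_f` is a fibre polynomial of
degree `4 N_f`. [folklore] -/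
theorem stub_twoStar_aux4 : ∀ (N Nf : ℕ) [NeZero N] (mq : Fin Nf → ℝ), IsFibrePoly (4 * Nf) (fun W : GaugeConfig 4 N (Matrix.specialUnitaryGroup (Fin 3) ℂ) => (diracMatrix W mq).det) :=
  fun _ _ _ mq => isFibrePoly_det_diracMatrix mq

end Summit.QuantumFields.QCD.Theorems.VonMisesCirclesC1
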